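import Literature.AlgebraicGeometry.ShimuraVarieties.UnitaryCurveAuxiliaryFrameDataV
import Literature.AlgebraicGeometry.ModuliOfAbelianVarieties.SiegelAdelicCongrTransport
import HarnessLib

/-!
# Twist data OF a symplectic frame: every E1 frame `Fr` with an integral `𝓞`-reading IS a frame at a twist `γ` (`P = T·γ`, `T ∈ GL(ℤ)`)

Topic `AlgebraicGeometry/ShimuraVarieties`; namespace `Literature.AlgebraicGeometry.ShimuraVarieties.UnitaryCurve.AuxV`.  THEOREMS ONLY (no
definition, no named fact, no instance, no notation, no `sorry`).  Cell `hodgecm-mathlib` (D-0151), FLOOR 0, P6 «MOD programme», crux item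
stmt-HodgeConjecture-24832 (hLiu418), X-LEAF socket `stub_EHECKE`, EHECKE closer organ (O-MP) STAGE B (deal L5-#11′, B-p08 (g35)); `--supports
stmt-HodgeConjecture-24832`, count-neutral; HC_CM is proved only modulo the printed citations until rung 0 closes; this file discharges none.

THE POINT.  The ★ lattice laws of the E-side Hecke roofs — (L-a)(L-b) ★ `reading_mulVec_mem_latticeOfGL_heckeNeighbour` ∕ `…_of_heckeNeighbour`, the
transporter laws (T-Λ)(T-Λ♭)(T-lvl) ★ `UnitaryCurveAuxiliaryHeckeTransporter` — are stated for a frame `Fr` AT A TWIST: a rational `γ ∈ GL_{2[F:ℚ]}(ℚ)`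
with integer change of frame `T, T′` (`T′T = 1`, `P = T·γ`), the lattice `γ⁻¹ℤ^{2[F:ℚ]}` being `𝓞_F`-stable (`hγS`) and `K × L₀`-stable (`hγ`) — the OUTPUT shape
of ★ `exists_latticeTwist` ∕ ★ `exists_symplecticFrameV_integralAction_of_twist` ([Kottwitz1992] §5 p. 390: the `𝒪_B`-lattice is chosen first, the
symplectic basis adapted to it).  A consumer that receives the frame through a LETTER (the X-leaf sockets bind `(ξ k Fr)` and a chart pin, not `γ`)
holds only: the frame `Fr`, an integer reading `ρ` of `𝓞_F` with `(ρ b)_ℚ = P·res(b•1)·Q`, and the level containment `K × L₀ ≤ K̃_{Fr}(1)`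
(★ `auxLevelV`).  This file shows that is enough: **`exists_twist_of_frame`** — such a frame IS a frame at a twist, namely `γ := T′_ℚ·P` for the
integer re-indexing `T` of `Fin g ⊕ Fin g ≃ Fin n × Fin [M:ℚ]` (the frame is a `ℚ`-linear isomorphism, so the index sets have the same cardinality),
with `hγS` read off `ρ` and `hγ` read off the level containment (the converse of ★ `prod_le_auxLevelV_one_of_framePV_eq`).
[Milne2005ShimuraVarieties] §6 p. 67 (the frame matrices `P`, `Q`); [Deligne1979ShimuraVarieties] Prop. 2.3.10; [PlatonovRapinchuk1994] §8.1 (a lattice and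
its stabiliser `GL(ẑ)`).

## References
* [Kottwitz1992] R. Kottwitz, *Points on some Shimura varieties over finite fields*, JAMS 5 (1992), §5 p. 390.
* [Milne2005ShimuraVarieties] J. S. Milne, *Introduction to Shimura varieties* (2005), §6 p. 67, Thm. 6.11 p. 74.
* [Deligne1979ShimuraVarieties] P. Deligne, *Variétés de Shimura* (1979), Prop. 2.3.10 (PDF p. 32 of Milne's translation).
* [PlatonovRapinchuk1994] V. Platonov, A. Rapinchuk, *Algebraic groups and number theory* (1994), §8.1.

#harness_tags number_theory.shimura_varieties, number_theory.adeles, linear_algebra.lattices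
-/

set_option autoImplicit false

noncomputable section

open Matrix NumberField IsDedekindDomain
open scoped TensorProduct
open Literature.AlgebraicGeometry.ModuliOfAbelianVarieties Literature.LinearAlgebra.FreeModule
open Literature.NumberTheory.Automorphic (integralFiniteAdeles)

namespace Literature.AlgebraicGeometry.ShimuraVarieties

namespace UnitaryCurve

namespace AuxV

open Literature.AlgebraicGeometry.ShimuraVarieties.UnitaryCanonicalModel.Aux (ratBasis torusFinAdelic forall_mem_integral_intConj map_intCast_mul)
open Literature.NumberTheory.Automorphic Literature.NumberTheory.Automorphic.UnitaryGroup

variable {L : Type} [Field L] [NumberField L] [IsCMField L] {M : Type} [Field M] [NumberField M] [IsCMField M]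
  {j : L →+* M} {n : ℕ} {H : Matrix (Fin n) (Fin n) L} {ξ : M} {g : ℕ} {δ : Fin g → ℕ}

/-! ### §1 The index sets of a frame have the same cardinality -/

omit [NumberField L] [IsCMField L] in
/-- A symplectic frame is a `ℚ`-linear isomorphism `(Fin n → M) ≃ (Fin g ⊕ Fin g → ℚ)`, so `#(Fin g ⊕ Fin g) = #(Fin n × Fin [M:ℚ])`.
[cite: Milne2005ShimuraVarieties, §6 p. 67] -/
theorem card_sum_eq_card_prod_of_frame (Fr : SymplecticFrameV M j H ξ g δ) :
    Fintype.card (Fin g ⊕ Fin g) = Fintype.card (Fin n × Fin (Module.finrank ℚ M)) := by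
  have h1 : Module.finrank ℚ (Fin n → M) = Module.finrank ℚ (Fin g ⊕ Fin g → ℚ) := Fr.β.finrank_eq
  rw [Module.finrank_pi_fintype, Module.finrank_fintype_fun_eq_card] at h1
  simp only [Finset.sum_const, Finset.card_univ, Fintype.card_fin, smul_eq_mul] at h1
  rw [Fintype.card_prod, Fintype.card_fin, Fintype.card_fin, ← h1]

/-! ### §2 THE HEAD: twist data of a frame -/

/-- **`exists_twist_of_frame` — EVERY INTEGRALLY-READ FRAME IS A FRAME AT A TWIST.**  For a symplectic frame `Fr` (frame matrices `P`, `Q`, `PQ = 1 = QP`),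
an integer reading `ρ : 𝓞 M → M_{2g}(ℤ)` of the scalars with `(ρ b)_ℚ = P·res(b•1)·Q`, and subgroups `K`, `L₀` with `K × L₀ ≤ K̃_{Fr}(1)` (`ũ_{Fr}(K × L₀) ⊆ K_δ(1)`),
there are `γ ∈ GL(ℚ)` and inverse INTEGER matrices `T, T′` (`T′T = 1`) with `P = T·γ` such that `γ·res(b•1)·γ⁻¹` is an integer matrix for every `b ∈ 𝓞 M`
(`hγS`) and `γ_𝔸·res(p)·γ_𝔸⁻¹`, `γ_𝔸·res(p)⁻¹·γ_𝔸⁻¹` are `ẑ`-integral for every `p ∈ K × L₀` (`hγ`) — the exact input shape of ★ (L-a)(L-b) and of the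
transporter laws (T-Λ)(T-Λ♭)(T-lvl).  Construction: `T` = the permutation matrix of a bijection `Fin g ⊕ Fin g ≃ Fin n × Fin [M:ℚ]`, `γ := T′_ℚ·P` (inverse
`Q·T_ℚ`); then `γ res γ⁻¹ = (T′·ρ(b)·T)_ℚ` and `γ_𝔸 res(p)^{±1} γ_𝔸⁻¹ = T′_𝔸·ũ(p)^{±1}·T_𝔸` with `ũ(p) ∈ K_δ(1) ≤ GL(ẑ)`.
[cite: Kottwitz1992, §5 p. 390] [cite: Milne2005ShimuraVarieties, §6 p. 67] [cite: Deligne1979ShimuraVarieties, Prop. 2.3.10 (PDF p. 32)]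
[cite: PlatonovRapinchuk1994, §8.1] -/
theorem exists_twist_of_frame (Fr : SymplecticFrameV M j H ξ g δ)
    (ρ : 𝓞 M → Matrix (Fin g ⊕ Fin g) (Fin g ⊕ Fin g) ℤ)
    (hρ : ∀ b : 𝓞 M, (ρ b).map (Int.cast : ℤ → ℚ) =
      framePV Fr * resMatrix (m := Fin n) (ratBasis M) (((b : 𝓞 M) : M) • (1 : Matrix (Fin n) (Fin n) M)) * frameQV Fr)
    (K : Subgroup ↥(finAdelic (↥(maximalRealSubfield L)) L (IsCMField.complexConj L) n H)) (L₀ : Subgroup ↥(torusFinAdelic M))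
    (hK : K.prod L₀ ≤ auxLevelV Fr 1) :
    ∃ (γ : GL (Fin n × Fin (Module.finrank ℚ M)) ℚ)
      (T : Matrix (Fin g ⊕ Fin g) (Fin n × Fin (Module.finrank ℚ M)) ℤ) (T' : Matrix (Fin n × Fin (Module.finrank ℚ M)) (Fin g ⊕ Fin g) ℤ),
      T' * T = 1 ∧
      framePV Fr = T.map (Int.cast : ℤ → ℚ) * ((γ : GL (Fin n × Fin (Module.finrank ℚ M)) ℚ) :
        Matrix (Fin n × Fin (Module.finrank ℚ M)) (Fin n × Fin (Module.finrank ℚ M)) ℚ) ∧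
      (∀ b : 𝓞 M, ∀ i i', ∃ z : ℤ,
        (((γ : GL (Fin n × Fin (Module.finrank ℚ M)) ℚ) : Matrix (Fin n × Fin (Module.finrank ℚ M)) (Fin n × Fin (Module.finrank ℚ M)) ℚ) *
              resMatrix (m := Fin n) (ratBasis M) (((b : 𝓞 M) : M) • (1 : Matrix (Fin n) (Fin n) M)) *
            ((γ⁻¹ : GL (Fin n × Fin (Module.finrank ℚ M)) ℚ) :
              Matrix (Fin n × Fin (Module.finrank ℚ M)) (Fin n × Fin (Module.finrank ℚ M)) ℚ)) i i' = (z : ℚ)) ∧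
      (∀ p ∈ K.prod L₀,
        (∀ i i', ((Matrix.GeneralLinearGroup.map (algebraMap ℚ finAdeleQ) γ * auxResFinV M j H p *
            (Matrix.GeneralLinearGroup.map (algebraMap ℚ finAdeleQ) γ)⁻¹ : GL (Fin n × Fin (Module.finrank ℚ M)) finAdeleQ) :
              Matrix (Fin n × Fin (Module.finrank ℚ M)) (Fin n × Fin (Module.finrank ℚ M)) finAdeleQ) i i' ∈ integralFiniteAdeles ℚ) ∧
        (∀ i i', ((Matrix.GeneralLinearGroup.map (algebraMap ℚ finAdeleQ) γ * (auxResFinV M j H p)⁻¹ *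
            (Matrix.GeneralLinearGroup.map (algebraMap ℚ finAdeleQ) γ)⁻¹ : GL (Fin n × Fin (Module.finrank ℚ M)) finAdeleQ) :
              Matrix (Fin n × Fin (Module.finrank ℚ M)) (Fin n × Fin (Module.finrank ℚ M)) finAdeleQ) i i' ∈ integralFiniteAdeles ℚ)) := by
  classical
  -- (0) the index bijection and its permutation matrices
  obtain ⟨e⟩ : Nonempty (Fin g ⊕ Fin g ≃ Fin n × Fin (Module.finrank ℚ M)) :=
    Fintype.card_eq.1 (card_sum_eq_card_prod_of_frame Fr)
  set T : Matrix (Fin g ⊕ Fin g) (Fin n × Fin (Module.finrank ℚ M)) ℤ := (1 : Matrix _ _ ℤ).submatrix id e.symm with hT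
  set T' : Matrix (Fin n × Fin (Module.finrank ℚ M)) (Fin g ⊕ Fin g) ℤ := (1 : Matrix _ _ ℤ).submatrix e.symm id with hT'
  have hT'T : T' * T = 1 := by
    rw [hT, hT', ← Matrix.submatrix_mul (1 : Matrix (Fin g ⊕ Fin g) (Fin g ⊕ Fin g) ℤ) 1 e.symm id e.symm Function.bijective_id,
      Matrix.mul_one, Matrix.submatrix_one_equiv]
  have hTT' : T * T' = 1 := by
    rw [hT, hT', ← Matrix.submatrix_mul (1 : Matrix (Fin g ⊕ Fin g) (Fin g ⊕ Fin g) ℤ) 1 id e.symm id e.symm.bijective,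
      Matrix.mul_one, Matrix.submatrix_id_id]
  set Tq : Matrix (Fin g ⊕ Fin g) (Fin n × Fin (Module.finrank ℚ M)) ℚ := T.map (Int.cast : ℤ → ℚ) with hTq
  set T'q : Matrix (Fin n × Fin (Module.finrank ℚ M)) (Fin g ⊕ Fin g) ℚ := T'.map (Int.cast : ℤ → ℚ) with hT'q
  have hT'Tq : T'q * Tq = 1 := by
    rw [hTq, hT'q, ← map_intCast_mul, hT'T, Matrix.map_one Int.cast Int.cast_zero Int.cast_one]
  have hTT'q : Tq * T'q = 1 := by
    rw [hTq, hT'q, ← map_intCast_mul, hTT', Matrix.map_one Int.cast Int.cast_zero Int.cast_one]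
  -- (1) the twist `γ := T′_ℚ · P`, inverse `Q · T_ℚ`
  set P := framePV Fr with hPdef
  set Q := frameQV Fr with hQdef
  have hPQ : P * Q = 1 := framePV_mul_frameQV Fr
  have hQP : Q * P = 1 := frameQV_mul_framePV Fr
  have hγ1 : T'q * P * (Q * Tq) = 1 := by
    rw [Matrix.mul_assoc, ← Matrix.mul_assoc P, hPQ, Matrix.one_mul, hT'Tq]
  have hγ2 : Q * Tq * (T'q * P) = 1 := by
    rw [Matrix.mul_assoc, ← Matrix.mul_assoc Tq, hTT'q, Matrix.one_mul, hQP]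
  let γ : GL (Fin n × Fin (Module.finrank ℚ M)) ℚ := ⟨T'q * P, Q * Tq, hγ1, hγ2⟩
  have hγv : ((γ : GL (Fin n × Fin (Module.finrank ℚ M)) ℚ) :
      Matrix (Fin n × Fin (Module.finrank ℚ M)) (Fin n × Fin (Module.finrank ℚ M)) ℚ) = T'q * P := rfl
  have hγi : ((γ⁻¹ : GL (Fin n × Fin (Module.finrank ℚ M)) ℚ) :
      Matrix (Fin n × Fin (Module.finrank ℚ M)) (Fin n × Fin (Module.finrank ℚ M)) ℚ) = Q * Tq := rfl
  refine ⟨γ, T, T', hT'T, ?_, ?_, ?_⟩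
  · -- `P = T · γ`
    rw [hγv, ← Matrix.mul_assoc, ← hTq, hTT'q, Matrix.one_mul]
  · -- `hγS`: `γ res(b•1) γ⁻¹ = (T′ ρ(b) T)_ℚ`
    intro b i i'
    refine ⟨(T' * ρ b * T) i i', ?_⟩
    have hres : resMatrix (m := Fin n) (ratBasis M) (((b : 𝓞 M) : M) • (1 : Matrix (Fin n) (Fin n) M)) = Q * (ρ b).map (Int.cast : ℤ → ℚ) * P := by
      rw [hρ]
      calc resMatrix (m := Fin n) (ratBasis M) (((b : 𝓞 M) : M) • (1 : Matrix (Fin n) (Fin n) M))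
          = (Q * P) * resMatrix (m := Fin n) (ratBasis M) (((b : 𝓞 M) : M) • (1 : Matrix (Fin n) (Fin n) M)) * (Q * P) := by
            rw [hQP, Matrix.one_mul, Matrix.mul_one]
        _ = Q * (P * resMatrix (m := Fin n) (ratBasis M) (((b : 𝓞 M) : M) • (1 : Matrix (Fin n) (Fin n) M)) * Q) * P := by
            simp only [Matrix.mul_assoc]
    rw [hγv, hγi, hres]
    have hprod : T'q * P * (Q * (ρ b).map (Int.cast : ℤ → ℚ) * P) * (Q * Tq) = (T' * ρ b * T).map (Int.cast : ℤ → ℚ) := by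
      rw [map_intCast_mul, map_intCast_mul, ← hTq, ← hT'q]
      calc T'q * P * (Q * (ρ b).map (Int.cast : ℤ → ℚ) * P) * (Q * Tq)
          = T'q * (P * Q) * (ρ b).map (Int.cast : ℤ → ℚ) * (P * Q) * Tq := by simp only [Matrix.mul_assoc]
        _ = T'q * (ρ b).map (Int.cast : ℤ → ℚ) * Tq := by rw [hPQ, Matrix.mul_one, Matrix.mul_one]
    rw [hprod, Matrix.map_apply]
  · -- `hγ`: `γ_𝔸 res(p)^{±1} γ_𝔸⁻¹ = T′_𝔸 · ũ(p)^{±1} · T_𝔸`, and `ũ(p) ∈ K_δ(1) ≤ GL(ẑ)`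
    intro p hp
    have hu := Literature.AlgebraicGeometry.ModuliOfAbelianVarieties.coe_mem_units_matrix_integralFiniteAdeles_of_mem_principalLevelSubgroup_one
      ((mem_auxLevelV_iff Fr 1 p).1 (hK hp))
    rw [Literature.NumberTheory.Adeles.mem_units_matrix_integralFiniteAdeles_iff] at hu
    obtain ⟨hu1, hu2⟩ := hu
    -- the adelic images of `γ`, `γ⁻¹`
    set ι𝔸 : ℚ →+* finAdeleQ := algebraMap ℚ finAdeleQ with hι
    have hγA : ((Matrix.GeneralLinearGroup.map ι𝔸 γ : GL (Fin n × Fin (Module.finrank ℚ M)) finAdeleQ) :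
        Matrix (Fin n × Fin (Module.finrank ℚ M)) (Fin n × Fin (Module.finrank ℚ M)) finAdeleQ) =
          T'.map (Int.cast : ℤ → finAdeleQ) * framePVR finAdeleQ Fr := by
      change (T'q * P).map ι𝔸 = _
      rw [Matrix.map_mul, framePVR, ← hPdef, hT'q, Matrix.map_map]
      congr 1
      ext a b'
      simp only [Matrix.map_apply, Function.comp_apply, map_intCast]
    have hγA' : (((Matrix.GeneralLinearGroup.map ι𝔸 γ)⁻¹ : GL (Fin n × Fin (Module.finrank ℚ M)) finAdeleQ) :
        Matrix (Fin n × Fin (Module.finrank ℚ M)) (Fin n × Fin (Module.finrank ℚ M)) finAdeleQ) =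
          frameQVR finAdeleQ Fr * T.map (Int.cast : ℤ → finAdeleQ) := by
      rw [← map_inv]
      change (Q * Tq).map ι𝔸 = _
      rw [Matrix.map_mul, frameQVR, ← hQdef, hTq, Matrix.map_map]
      congr 1
      ext a b'
      simp only [Matrix.map_apply, Function.comp_apply, map_intCast]
    have key : ∀ Z : GL (Fin n × Fin (Module.finrank ℚ M)) finAdeleQ,
        ((Matrix.GeneralLinearGroup.map ι𝔸 γ * Z * (Matrix.GeneralLinearGroup.map ι𝔸 γ)⁻¹ :
          GL (Fin n × Fin (Module.finrank ℚ M)) finAdeleQ) :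
            Matrix (Fin n × Fin (Module.finrank ℚ M)) (Fin n × Fin (Module.finrank ℚ M)) finAdeleQ) =
          T'.map (Int.cast : ℤ → finAdeleQ) *
            (((conjRect (framePVR finAdeleQ Fr) (frameQVR finAdeleQ Fr) (framePVR_mul_frameQVR finAdeleQ Fr) (frameQVR_mul_framePVR finAdeleQ Fr) Z :
              GL (Fin g ⊕ Fin g) finAdeleQ)) : Matrix (Fin g ⊕ Fin g) (Fin g ⊕ Fin g) finAdeleQ) *
            T.map (Int.cast : ℤ → finAdeleQ) := by
      intro Z
      rw [Units.val_mul, Units.val_mul, hγA, hγA', coe_conjRect]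
      simp only [Matrix.mul_assoc]
    refine ⟨fun i i' => ?_, fun i i' => ?_⟩
    · rw [key]
      refine forall_mem_integral_intConj T' T (fun a b' => ?_) i i'
      rw [← coe_auxToGspFinV_eq_conjRect]
      exact hu1 a b'
    · rw [key]
      refine forall_mem_integral_intConj T' T (fun a b' => ?_) i i'
      rw [map_inv, ← coe_auxToGspFinV_eq_conjRect]
      exact hu2 a b'

end AuxV

end UnitaryCurve

end Literature.AlgebraicGeometry.ShimuraVarieties

end
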